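import Mathlib.Algebra.Order.Chebyshev
import Literature.NumberTheory.LFunctions.DirichletPolynomialMeanValueThm52
import Literature.NumberTheory.LFunctions.DirichletPolynomialGallagher
import HarnessLib

/-!
# The first absolute moment of a trigonometric polynomial over primes

Trunk T-ANT (`Literature/NumberTheory/LFunctions`). Proofs only (no named facts). For a finite
set `S` of primes `p ≤ N` and complex coefficients `a_p`, put
`Z(t) = Σ_{p ∈ S} a_p p^{it}`, `F(t) = Im Z(t)`, `V = Σ |a_p|²`. The classical route from even
moments to the first absolute moment (as in Selberg's and Tsang's work on `S(t)`, and in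
Titchmarsh §9.26 for `S(t+h) − S(t)`): the mean value theorem for Dirichlet polynomials
(Montgomery–Vaughan; Ivić Thm. 5.2, PROVED in the tree as
`Literature.NumberTheory.LFunctions.integral_norm_sq_dirichletPoly_sub_le`) gives
`∫_T^{2T} F² ≥ TV/4` (when `Σ p|a_p|²` and `(Σ|a_p|)²` are small against `TV`) and — because a
product of two primes determines the pair — `∫_T^{2T} F⁴ ≤ ∫_0^{2T} |Z²|² ≤ 6 T V²` (when
`N² ≪ T`), and two applications of Cauchy–Schwarz give `(∫ F²)³ ≤ (∫ |F|)² ∫ F⁴`, whence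
`∫_T^{2T} |F| ≥ T √V / 20`. This is the main-term engine for `L¹` lower bounds of
`S(t + h) − S(t)` (programme recorded in `SelbergFujiiSmallGaps.lean`).

## Main results (all proved)

* `Literature.NumberTheory.LFunctions.PrimeTrigPoly.integral_norm_sq_window` — the mean value
  theorem on the window `[T, 2T]`: `|∫_T^{2T} |Σ_{n≤N} b_n n^{it}|² − T Σ|b_n|²| ≤ 1856 Σ n|b_n|²`.
* `Literature.NumberTheory.LFunctions.PrimeTrigPoly.primePoly_sq_eq` — `Z² = Σ_{k ≤ N²} c_k k^{it}`
  with `c_k = Σ_{pq = k} a_p a_q`; `…sum_norm_sq_sqCoeff_le` — `Σ |c_k|² ≤ 2 V²` (primes).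
* `Literature.NumberTheory.LFunctions.PrimeTrigPoly.norm_integral_primePoly_sq_le` —
  `|∫_T^{2T} Z²| ≤ 4 (Σ |a_p|)²` (every frequency `log(pq) ≥ log 4`, primitive of modulus `< 2`).
* `Literature.NumberTheory.LFunctions.PrimeTrigPoly.pow_three_integral_sq_le` — Hölder:
  `(∫ F²)³ ≤ (∫ |F|)² ∫ F⁴` for continuous real `F`.
* `Literature.NumberTheory.LFunctions.PrimeTrigPoly.first_moment_ge` — **the `L¹` bound**: if
  `1856 Σ p|a_p|² + 4(Σ|a_p|)² ≤ TV/2` and `928 N² ≤ T` then `∫_T^{2T} |Im Z(t)| dt ≥ T √V/20`.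

## References

* A. Ivić, *The Riemann Zeta-Function*, Wiley 1985, Thm. 5.2. [key `Ivic1985`]
* E. C. Titchmarsh, *The Theory of the Riemann Zeta-Function*, 2nd ed. (1986), §9.26 (Hölder
  step). [key `Titchmarsh1986`]
* K.-M. Tsang, *Some Ω-theorems for the Riemann zeta-function*, Acta Arith. 46 (1986), §2.
-/

noncomputable section

open Complex Real MeasureTheory Set Filter intervalIntegral Finset

namespace Literature.NumberTheory.LFunctions

namespace PrimeTrigPoly

/-! ### Dirichlet polynomials in the normal form of Ivić Thm. 5.2 -/

/-- `n^{it}` is continuous in `t` for `n ≥ 1`. [folklore] -/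
theorem continuous_natCast_cpow {n : ℕ} (hn : n ≠ 0) :
    Continuous fun t : ℝ ↦ (n : ℂ) ^ ((t : ℂ) * I) :=
  Continuous.const_cpow (by fun_prop) (Or.inl (by exact_mod_cast hn))

/-- A Dirichlet polynomial is continuous. [folklore] -/
theorem continuous_dirPoly (N : ℕ) (b : ℕ → ℂ) : Continuous fun t : ℝ ↦ ∑ n ∈ Finset.Icc 1 N, b n * (n : ℂ) ^ ((t : ℂ) * I) := by
  refine continuous_finsetSum _ fun n hn ↦ continuous_const.mul ?_
  exact continuous_natCast_cpow (by have := (Finset.mem_Icc.1 hn).1; omega)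

/-- **Mean value theorem on the window `[T, 2T]`** (from Ivić Thm. 5.2 at `2T` and at `T`):
`|∫_T^{2T} |Σ_{n≤N} b_n n^{it}|² dt − T Σ |b_n|²| ≤ 1856 Σ n |b_n|²`. [cite: Ivic1985, Theorem 5.2] -/
theorem integral_norm_sq_window (N : ℕ) (b : ℕ → ℂ) (T : ℝ) :
    |(∫ t in T..2 * T, ‖∑ n ∈ Finset.Icc 1 N, b n * (n : ℂ) ^ ((t : ℂ) * I)‖ ^ 2) -
        T * ∑ n ∈ Finset.Icc 1 N, ‖b n‖ ^ 2| ≤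
      1856 * ∑ n ∈ Finset.Icc 1 N, (n : ℝ) * ‖b n‖ ^ 2 := by
  have h1 := integral_norm_sq_dirichletPoly_sub_le N b T
  have h2 := integral_norm_sq_dirichletPoly_sub_le N b (2 * T)
  have hint : ∀ x y : ℝ, IntervalIntegrable (fun t : ℝ ↦ ‖(∑ n ∈ Finset.Icc 1 N, b n * (n : ℂ) ^ ((t : ℂ) * I))‖ ^ 2) volume x y :=
    fun x y ↦ ((continuous_dirPoly N b).norm.pow 2).intervalIntegrable x y
  have hsplit : ∫ t in T..2 * T, ‖(∑ n ∈ Finset.Icc 1 N, b n * (n : ℂ) ^ ((t : ℂ) * I))‖ ^ 2 =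
      (∫ t in (0 : ℝ)..2 * T, ‖(∑ n ∈ Finset.Icc 1 N, b n * (n : ℂ) ^ ((t : ℂ) * I))‖ ^ 2) - ∫ t in (0 : ℝ)..T, ‖(∑ n ∈ Finset.Icc 1 N, b n * (n : ℂ) ^ ((t : ℂ) * I))‖ ^ 2 := by
    rw [← integral_add_adjacent_intervals (hint 0 T) (hint T (2 * T))]; ring
  rw [hsplit]
  rw [abs_le] at h1 h2 ⊢
  constructor <;> linarith [h1.1, h1.2, h2.1, h2.2]

/-! ### The polynomial over primes and its square -/


variable {S : Finset ℕ} {a : ℕ → ℂ} {N : ℕ}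

/-- `Z` as a Dirichlet polynomial of length `N` (`S ⊆ [1, N]`). [folklore] -/
theorem primePoly_eq_dirPoly (hS : S ⊆ Finset.Icc 1 N) (t : ℝ) :
    (∑ p ∈ S, a p * (p : ℂ) ^ ((t : ℂ) * I)) = (∑ n ∈ Finset.Icc 1 N, (if n ∈ S then a n else (0 : ℂ)) * (n : ℂ) ^ ((t : ℂ) * I)) := by
  rw [← Finset.sum_subset hS (f := fun n ↦
    (if n ∈ S then a n else (0 : ℂ)) * (n : ℂ) ^ ((t : ℂ) * I))]
  · exact Finset.sum_congr rfl fun n hn ↦ by rw [if_pos hn]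
  · intro n _ hn; rw [if_neg hn, zero_mul]

/-- `Z` is continuous. [folklore] -/
theorem continuous_primePoly (hS : S ⊆ Finset.Icc 1 N) : Continuous fun t : ℝ ↦ ∑ p ∈ S, a p * (p : ℂ) ^ ((t : ℂ) * I) := by
  have : (fun t : ℝ ↦ ∑ p ∈ S, a p * (p : ℂ) ^ ((t : ℂ) * I)) =
      fun t : ℝ ↦ ∑ n ∈ Finset.Icc 1 N, (if n ∈ S then a n else (0 : ℂ)) * (n : ℂ) ^ ((t : ℂ) * I) :=
    funext (primePoly_eq_dirPoly hS)
  rw [this]; exact continuous_dirPoly _ _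

/-- Norms of the restricted coefficients. [folklore] -/
theorem sum_norm_sq_restrictCoeff (hS : S ⊆ Finset.Icc 1 N) :
    ∑ n ∈ Finset.Icc 1 N, ‖(if n ∈ S then a n else (0 : ℂ))‖ ^ 2 = ∑ p ∈ S, ‖a p‖ ^ 2 := by
  rw [← Finset.sum_subset hS (f := fun n ↦ ‖(if n ∈ S then a n else (0 : ℂ))‖ ^ 2)]
  · exact Finset.sum_congr rfl fun n hn ↦ by rw [if_pos hn]
  · intro n _ hn; rw [if_neg hn]; simp

/-- Weighted norms of the restricted coefficients. [folklore] -/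
theorem sum_mul_norm_sq_restrictCoeff (hS : S ⊆ Finset.Icc 1 N) :
    ∑ n ∈ Finset.Icc 1 N, (n : ℝ) * ‖(if n ∈ S then a n else (0 : ℂ))‖ ^ 2 = ∑ p ∈ S, (p : ℝ) * ‖a p‖ ^ 2 := by
  rw [← Finset.sum_subset hS (f := fun n : ℕ ↦ (n : ℝ) * ‖(if n ∈ S then a n else (0 : ℂ))‖ ^ 2)]
  · exact Finset.sum_congr rfl fun n hn ↦ by rw [if_pos hn]
  · intro n _ hn; rw [if_neg hn]; simp

/-- **`Z²` is a Dirichlet polynomial of length `N²`**: `Z(t)² = Σ_{k ≤ N²} c_k k^{it}`,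
`c_k = Σ_{pq = k} a_p a_q`. [folklore] -/
theorem primePoly_sq_eq (hS : S ⊆ Finset.Icc 1 N) (t : ℝ) :
    (∑ p ∈ S, a p * (p : ℂ) ^ ((t : ℂ) * I)) ^ 2 = (∑ k ∈ Finset.Icc 1 (N * N), (∑ x ∈ (S ×ˢ S).filter (fun x ↦ x.1 * x.2 = k), a x.1 * a x.2) * (k : ℂ) ^ ((t : ℂ) * I)) := by
  rw [sq, Finset.sum_mul_sum, ← Finset.sum_product']
  have hmaps : ∀ x ∈ S ×ˢ S, x.1 * x.2 ∈ Finset.Icc 1 (N * N) := by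
    intro x hx
    rw [Finset.mem_product] at hx
    have h1 := Finset.mem_Icc.1 (hS hx.1)
    have h2 := Finset.mem_Icc.1 (hS hx.2)
    rw [Finset.mem_Icc]
    exact ⟨Nat.one_le_iff_ne_zero.2 (Nat.mul_ne_zero (by omega) (by omega)),
      Nat.mul_le_mul h1.2 h2.2⟩
  rw [← Finset.sum_fiberwise_of_maps_to hmaps]
  refine Finset.sum_congr rfl fun k _ ↦ ?_
  rw [Finset.sum_mul]
  refine Finset.sum_congr rfl fun x hx ↦ ?_
  rw [Finset.mem_filter] at hx
  rw [← hx.2, Nat.cast_mul, Complex.natCast_mul_natCast_cpow]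
  ring

/-- The fibre of `k` in `S × S` under multiplication has at most two elements when `S` consists of
primes (a product of two primes determines the unordered pair). [folklore] -/
theorem card_filter_mul_eq_le_two (hP : ∀ p ∈ S, p.Prime) (k : ℕ) :
    ((S ×ˢ S).filter fun x ↦ x.1 * x.2 = k).card ≤ 2 := by
  by_cases hne : ((S ×ˢ S).filter fun x ↦ x.1 * x.2 = k).Nonempty
  · obtain ⟨x₀, hx₀⟩ := hne
    rw [Finset.mem_filter, Finset.mem_product] at hx₀
    have hp₀ := hP _ hx₀.1.1
    have hq₀ := hP _ hx₀.1.2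
    have hsub : ((S ×ˢ S).filter fun x ↦ x.1 * x.2 = k) ⊆ {x₀, x₀.swap} := by
      intro x hx
      rw [Finset.mem_filter, Finset.mem_product] at hx
      have hp := hP _ hx.1.1
      have hq := hP _ hx.1.2
      have heq : x.1 * x.2 = x₀.1 * x₀.2 := by rw [hx.2, hx₀.2]
      have hdvd : x.1 ∣ x₀.1 * x₀.2 := ⟨x.2, heq.symm⟩
      rw [Finset.mem_insert, Finset.mem_singleton]
      rcases (Nat.Prime.dvd_mul hp).1 hdvd with h | h
      · have h1 : x.1 = x₀.1 := (Nat.prime_dvd_prime_iff_eq hp hp₀).1 h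
        have h2 : x.2 = x₀.2 := by
          rw [h1] at heq; exact Nat.eq_of_mul_eq_mul_left hp₀.pos heq
        exact Or.inl (Prod.ext h1 h2)
      · have h1 : x.1 = x₀.2 := (Nat.prime_dvd_prime_iff_eq hp hq₀).1 h
        have h2 : x.2 = x₀.1 := by
          rw [h1, mul_comm x₀.1] at heq; exact Nat.eq_of_mul_eq_mul_left hq₀.pos heq
        exact Or.inr (Prod.ext h1 h2)
    exact (Finset.card_le_card hsub).trans (Finset.card_insert_le _ _ |>.trans (by simp))
  · rw [Finset.not_nonempty_iff_eq_empty.1 hne]; simp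

/-- **The coefficients of `Z²` in mean square**: `Σ_k |c_k|² ≤ 2 (Σ_p |a_p|²)²` for a set of
primes `S`. [folklore] -/
theorem sum_norm_sq_sqCoeff_le (hP : ∀ p ∈ S, p.Prime) (hS : S ⊆ Finset.Icc 1 N) :
    ∑ k ∈ Finset.Icc 1 (N * N), ‖(∑ x ∈ (S ×ˢ S).filter (fun x ↦ x.1 * x.2 = k), a x.1 * a x.2)‖ ^ 2 ≤ 2 * (∑ p ∈ S, ‖a p‖ ^ 2) ^ 2 := by
  have hmaps : ∀ x ∈ S ×ˢ S, x.1 * x.2 ∈ Finset.Icc 1 (N * N) := by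
    intro x hx
    rw [Finset.mem_product] at hx
    have h1 := Finset.mem_Icc.1 (hS hx.1)
    have h2 := Finset.mem_Icc.1 (hS hx.2)
    rw [Finset.mem_Icc]
    exact ⟨Nat.one_le_iff_ne_zero.2 (Nat.mul_ne_zero (by omega) (by omega)),
      Nat.mul_le_mul h1.2 h2.2⟩
  -- pointwise Cauchy–Schwarz on each fibre (of cardinality ≤ 2)
  have hk : ∀ k ∈ Finset.Icc 1 (N * N), ‖(∑ x ∈ (S ×ˢ S).filter (fun x ↦ x.1 * x.2 = k), a x.1 * a x.2)‖ ^ 2 ≤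
      2 * ∑ x ∈ (S ×ˢ S).filter (fun x ↦ x.1 * x.2 = k), ‖a x.1‖ ^ 2 * ‖a x.2‖ ^ 2 := by
    intro k _
    have h1 : ‖(∑ x ∈ (S ×ˢ S).filter (fun x ↦ x.1 * x.2 = k), a x.1 * a x.2)‖ ≤ ∑ x ∈ (S ×ˢ S).filter (fun x ↦ x.1 * x.2 = k), ‖a x.1 * a x.2‖ :=
      norm_sum_le _ _
    have h2 := sq_sum_le_card_mul_sum_sq (s := (S ×ˢ S).filter (fun x ↦ x.1 * x.2 = k))
      (f := fun x ↦ ‖a x.1 * a x.2‖)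
    have hcard : (((S ×ˢ S).filter fun x ↦ x.1 * x.2 = k).card : ℝ) ≤ 2 := by
      exact_mod_cast card_filter_mul_eq_le_two hP k
    have hnn : 0 ≤ ∑ x ∈ (S ×ˢ S).filter (fun x ↦ x.1 * x.2 = k), ‖a x.1 * a x.2‖ ^ 2 :=
      Finset.sum_nonneg fun x _ ↦ sq_nonneg _
    calc ‖(∑ x ∈ (S ×ˢ S).filter (fun x ↦ x.1 * x.2 = k), a x.1 * a x.2)‖ ^ 2
        ≤ (∑ x ∈ (S ×ˢ S).filter (fun x ↦ x.1 * x.2 = k), ‖a x.1 * a x.2‖) ^ 2 :=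
          pow_le_pow_left₀ (norm_nonneg _) h1 2
      _ ≤ ((S ×ˢ S).filter fun x ↦ x.1 * x.2 = k).card *
            ∑ x ∈ (S ×ˢ S).filter (fun x ↦ x.1 * x.2 = k), ‖a x.1 * a x.2‖ ^ 2 := h2
      _ ≤ 2 * ∑ x ∈ (S ×ˢ S).filter (fun x ↦ x.1 * x.2 = k), ‖a x.1 * a x.2‖ ^ 2 :=
          mul_le_mul_of_nonneg_right hcard hnn
      _ = 2 * ∑ x ∈ (S ×ˢ S).filter (fun x ↦ x.1 * x.2 = k), ‖a x.1‖ ^ 2 * ‖a x.2‖ ^ 2 := by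
          congr 1
          exact Finset.sum_congr rfl fun x _ ↦ by rw [norm_mul, mul_pow]
  calc ∑ k ∈ Finset.Icc 1 (N * N), ‖(∑ x ∈ (S ×ˢ S).filter (fun x ↦ x.1 * x.2 = k), a x.1 * a x.2)‖ ^ 2
      ≤ ∑ k ∈ Finset.Icc 1 (N * N),
          2 * ∑ x ∈ (S ×ˢ S).filter (fun x ↦ x.1 * x.2 = k), ‖a x.1‖ ^ 2 * ‖a x.2‖ ^ 2 :=
        Finset.sum_le_sum hk
    _ = 2 * ∑ x ∈ S ×ˢ S, ‖a x.1‖ ^ 2 * ‖a x.2‖ ^ 2 := by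
        rw [← Finset.mul_sum, Finset.sum_fiberwise_of_maps_to hmaps]
    _ = 2 * (∑ p ∈ S, ‖a p‖ ^ 2) ^ 2 := by
        rw [sq, Finset.sum_mul_sum, ← Finset.sum_product']

/-- Weighted version: `Σ_k k |c_k|² ≤ 2 N² (Σ_p |a_p|²)²`. [folklore] -/
theorem sum_mul_norm_sq_sqCoeff_le (hP : ∀ p ∈ S, p.Prime) (hS : S ⊆ Finset.Icc 1 N) :
    ∑ k ∈ Finset.Icc 1 (N * N), (k : ℝ) * ‖(∑ x ∈ (S ×ˢ S).filter (fun x ↦ x.1 * x.2 = k), a x.1 * a x.2)‖ ^ 2 ≤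
      2 * (N : ℝ) ^ 2 * (∑ p ∈ S, ‖a p‖ ^ 2) ^ 2 := by
  calc ∑ k ∈ Finset.Icc 1 (N * N), (k : ℝ) * ‖(∑ x ∈ (S ×ˢ S).filter (fun x ↦ x.1 * x.2 = k), a x.1 * a x.2)‖ ^ 2
      ≤ ∑ k ∈ Finset.Icc 1 (N * N), (N : ℝ) ^ 2 * ‖(∑ x ∈ (S ×ˢ S).filter (fun x ↦ x.1 * x.2 = k), a x.1 * a x.2)‖ ^ 2 := by
        refine Finset.sum_le_sum fun k hk ↦ mul_le_mul_of_nonneg_right ?_ (sq_nonneg _)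
        have := (Finset.mem_Icc.1 hk).2
        rw [sq]; exact_mod_cast this
    _ = (N : ℝ) ^ 2 * ∑ k ∈ Finset.Icc 1 (N * N), ‖(∑ x ∈ (S ×ˢ S).filter (fun x ↦ x.1 * x.2 = k), a x.1 * a x.2)‖ ^ 2 := by rw [Finset.mul_sum]
    _ ≤ (N : ℝ) ^ 2 * (2 * (∑ p ∈ S, ‖a p‖ ^ 2) ^ 2) :=
        mul_le_mul_of_nonneg_left (sum_norm_sq_sqCoeff_le hP hS) (sq_nonneg _)
    _ = _ := by ring

/-! ### The integral of `Z²` over `[T, 2T]` is small -/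

/-- For an integer `n ≥ 2` and any `T₁, T₂`, `|∫_{T₁}^{T₂} n^{it} dt| ≤ 4`: the primitive
`n^{it}/(i log n)` has modulus `1/log n ≤ 1/log 2 < 2`. [folklore] -/
theorem norm_integral_natCast_cpow_le {n : ℕ} (hn : 2 ≤ n) (T₁ T₂ : ℝ) :
    ‖∫ t in T₁..T₂, (n : ℂ) ^ ((t : ℂ) * I)‖ ≤ 4 := by
  have hn0 : n ≠ 0 := by omega
  have hlog : Real.log 2 ≤ Real.log n := Real.log_le_log (by norm_num) (by exact_mod_cast hn)
  have hlog2 : (1 / 2 : ℝ) < Real.log 2 := by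
    have := Real.log_two_gt_d9; linarith
  have hlogpos : 0 < Real.log n := by linarith
  set c : ℂ := (Real.log n : ℂ) * I with hc
  have hc0 : c ≠ 0 := by
    rw [hc]; exact mul_ne_zero (by exact_mod_cast hlogpos.ne') I_ne_zero
  -- primitive of `exp(c t)`
  have hderiv : ∀ t : ℝ, HasDerivAt (fun t : ℝ ↦ cexp (c * t) / c) (cexp (c * t)) t := by
    intro t
    have h1 : HasDerivAt (fun t : ℝ ↦ cexp (c * t)) (cexp (c * t) * c) t := by
      have := ((hasDerivAt_id (t : ℂ)).const_mul c).cexp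
      simpa using this.comp_ofReal
    have := h1.div_const c
    rwa [mul_div_cancel_right₀ _ hc0] at this
  have heq : ∀ t : ℝ, (n : ℂ) ^ ((t : ℂ) * I) = cexp (c * t) := fun t ↦ by
    rw [natCast_cpow_mul_I_eq_cexp hn0, hc]
  simp_rw [heq]
  rw [integral_eq_sub_of_hasDerivAt (fun t _ ↦ hderiv t)
    ((Continuous.cexp (by fun_prop)).intervalIntegrable _ _)]
  have hnorm : ∀ t : ℝ, ‖cexp (c * t) / c‖ ≤ 2 := fun t ↦ by
    rw [norm_div, hc]
    have e1 : ‖cexp ((Real.log n : ℂ) * I * t)‖ = 1 := by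
      rw [show (Real.log n : ℂ) * I * t = ((Real.log n * t : ℝ) : ℂ) * I by push_cast; ring,
        Complex.norm_exp_ofReal_mul_I]
    rw [e1, norm_mul, Complex.norm_I, mul_one, Complex.norm_real, Real.norm_eq_abs,
      abs_of_pos hlogpos, div_le_iff₀ hlogpos]
    linarith
  calc ‖cexp (c * T₂) / c - cexp (c * T₁) / c‖ ≤ ‖cexp (c * T₂) / c‖ + ‖cexp (c * T₁) / c‖ :=
        norm_sub_le _ _
    _ ≤ 2 + 2 := add_le_add (hnorm T₂) (hnorm T₁)
    _ = 4 := by norm_num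

/-- **`∫_T^{2T} Z(t)² dt` is small**: `‖∫_{T₁}^{T₂} Z²‖ ≤ 4 (Σ_p |a_p|)²` when every element of `S`
is at least `2` (all frequencies `log(pq)` are bounded away from `0`). [folklore] -/
theorem norm_integral_primePoly_sq_le (h2 : ∀ p ∈ S, 2 ≤ p) (T₁ T₂ : ℝ) :
    ‖∫ t in T₁..T₂, (∑ p ∈ S, a p * (p : ℂ) ^ ((t : ℂ) * I)) ^ 2‖ ≤ 4 * (∑ p ∈ S, ‖a p‖) ^ 2 := by
  have hterm : ∀ t : ℝ, (∑ p ∈ S, a p * (p : ℂ) ^ ((t : ℂ) * I)) ^ 2 =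
      ∑ x ∈ S ×ˢ S, a x.1 * a x.2 * (((x.1 * x.2 : ℕ) : ℂ) ^ ((t : ℂ) * I)) := by
    intro t
    rw [sq, Finset.sum_mul_sum, ← Finset.sum_product']
    refine Finset.sum_congr rfl fun x _ ↦ ?_
    rw [Nat.cast_mul, Complex.natCast_mul_natCast_cpow]; ring
  simp_rw [hterm]
  have hcont : ∀ x ∈ S ×ˢ S, Continuous fun t : ℝ ↦
      a x.1 * a x.2 * (((x.1 * x.2 : ℕ) : ℂ) ^ ((t : ℂ) * I)) := by
    intro x hx
    rw [Finset.mem_product] at hx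
    refine continuous_const.mul (continuous_natCast_cpow ?_)
    exact Nat.mul_ne_zero (by have := h2 _ hx.1; omega) (by have := h2 _ hx.2; omega)
  rw [intervalIntegral.integral_finsetSum fun x hx ↦ (hcont x hx).intervalIntegrable _ _]
  calc ‖∑ x ∈ S ×ˢ S, ∫ t in T₁..T₂, a x.1 * a x.2 * (((x.1 * x.2 : ℕ) : ℂ) ^ ((t : ℂ) * I))‖
      ≤ ∑ x ∈ S ×ˢ S, ‖∫ t in T₁..T₂, a x.1 * a x.2 * (((x.1 * x.2 : ℕ) : ℂ) ^ ((t : ℂ) * I))‖ :=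
        norm_sum_le _ _
    _ ≤ ∑ x ∈ S ×ˢ S, ‖a x.1‖ * ‖a x.2‖ * 4 := by
        refine Finset.sum_le_sum fun x hx ↦ ?_
        rw [Finset.mem_product] at hx
        rw [intervalIntegral.integral_const_mul, norm_mul, norm_mul]
        refine mul_le_mul_of_nonneg_left (norm_integral_natCast_cpow_le ?_ _ _) (by positivity)
        exact le_trans (h2 _ hx.1) (Nat.le_mul_of_pos_right _ (by have := h2 _ hx.2; omega))
    _ = 4 * (∑ p ∈ S, ‖a p‖) ^ 2 := by
        rw [← Finset.sum_mul, sq, Finset.sum_mul_sum, ← Finset.sum_product']; ring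

/-! ### Hölder: the first moment from the second and the fourth -/

/-- **Hölder's inequality in the form `(∫ F²)³ ≤ (∫ |F|)² ∫ F⁴`** for a continuous real `F` on
`[T₁, T₂]` (two applications of Cauchy–Schwarz: `∫F² = ∫ √|F| · √|F| |F|` and
`∫ |F|³ = ∫ |F| · F²`). [cite: Titchmarsh1986, §9.26] -/
theorem pow_three_integral_sq_le {F : ℝ → ℝ} (hF : Continuous F) {T₁ T₂ : ℝ} (hT : T₁ ≤ T₂) :
    (∫ t in T₁..T₂, F t ^ 2) ^ 3 ≤ (∫ t in T₁..T₂, |F t|) ^ 2 * ∫ t in T₁..T₂, F t ^ 4 := by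
  have hc1 : Continuous fun t ↦ Real.sqrt |F t| := hF.abs.sqrt
  have hc2 : Continuous fun t ↦ Real.sqrt |F t| * |F t| := hc1.mul hF.abs
  have hc3 : Continuous fun t ↦ |F t| := hF.abs
  have hc4 : Continuous fun t ↦ F t ^ 2 := hF.pow 2
  -- first Cauchy–Schwarz: `∫ F² ≤ √(∫|F|) √(∫|F|³)`
  have h1 := Gallagher.integral_mul_le_sqrt_mul_sqrt hT hc1 hc2
  have e1 : ∀ t, Real.sqrt |F t| * (Real.sqrt |F t| * |F t|) = F t ^ 2 := fun t ↦ by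
    rw [← mul_assoc, Real.mul_self_sqrt (abs_nonneg _), ← sq_abs, sq]
  have e2 : ∀ t, Real.sqrt |F t| ^ 2 = |F t| := fun t ↦ Real.sq_sqrt (abs_nonneg _)
  have e3 : ∀ t, (Real.sqrt |F t| * |F t|) ^ 2 = |F t| * F t ^ 2 := fun t ↦ by
    rw [mul_pow, Real.sq_sqrt (abs_nonneg _), sq_abs]
  simp_rw [e1, e2, e3] at h1
  -- second Cauchy–Schwarz: `∫ |F|³ ≤ √(∫F²) √(∫F⁴)`
  have h2 := Gallagher.integral_mul_le_sqrt_mul_sqrt hT hc3 hc4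
  have e4 : ∀ t, |F t| ^ 2 = F t ^ 2 := fun t ↦ sq_abs _
  have e5 : ∀ t, (F t ^ 2) ^ 2 = F t ^ 4 := fun t ↦ by ring
  simp_rw [e4, e5] at h2
  -- nonnegativity of everything
  have hA : 0 ≤ ∫ t in T₁..T₂, |F t| := integral_nonneg hT fun t _ ↦ abs_nonneg _
  have hB : 0 ≤ ∫ t in T₁..T₂, F t ^ 2 := integral_nonneg hT fun t _ ↦ sq_nonneg _
  have hC : 0 ≤ ∫ t in T₁..T₂, |F t| * F t ^ 2 :=
    integral_nonneg hT fun t _ ↦ mul_nonneg (abs_nonneg _) (sq_nonneg _)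
  have hD : 0 ≤ ∫ t in T₁..T₂, F t ^ 4 := integral_nonneg hT fun t _ ↦ by positivity
  set A := ∫ t in T₁..T₂, |F t|
  set B := ∫ t in T₁..T₂, F t ^ 2
  set C := ∫ t in T₁..T₂, |F t| * F t ^ 2
  set D := ∫ t in T₁..T₂, F t ^ 4
  -- `B² ≤ A C` and `C² ≤ B D`
  have h1' : B ^ 2 ≤ A * C := by
    calc B ^ 2 ≤ (Real.sqrt A * Real.sqrt C) ^ 2 := pow_le_pow_left₀ hB h1 2
      _ = A * C := by rw [mul_pow, Real.sq_sqrt hA, Real.sq_sqrt hC]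
  have h2' : C ^ 2 ≤ B * D := by
    calc C ^ 2 ≤ (Real.sqrt B * Real.sqrt D) ^ 2 := pow_le_pow_left₀ hC h2 2
      _ = B * D := by rw [mul_pow, Real.sq_sqrt hB, Real.sq_sqrt hD]
  -- `B⁴ ≤ A² C² ≤ A² B D`, hence `B³ ≤ A² D` (if `B = 0` trivially)
  rcases hB.eq_or_lt with hB0 | hBpos
  · rw [← hB0]; simp only [ne_eq, OfNat.ofNat_ne_zero, not_false_eq_true, zero_pow]; positivity
  · have h3 : B ^ 4 ≤ A ^ 2 * (B * D) :=
      calc B ^ 4 = (B ^ 2) ^ 2 := by ring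
        _ ≤ (A * C) ^ 2 := pow_le_pow_left₀ (sq_nonneg _) h1' 2
        _ = A ^ 2 * C ^ 2 := by ring
        _ ≤ A ^ 2 * (B * D) := mul_le_mul_of_nonneg_left h2' (sq_nonneg _)
    have h4 : B ^ 3 * B ≤ (A ^ 2 * D) * B := by nlinarith
    exact le_of_mul_le_mul_right h4 hBpos

/-! ### The first moment -/

/-- `(Im z)² = (|z|² − Re z²)/2`. [folklore] -/
theorem im_sq_eq (z : ℂ) : z.im ^ 2 = (‖z‖ ^ 2 - (z ^ 2).re) / 2 := by
  rw [Complex.sq_norm, Complex.normSq_apply, pow_two z, Complex.mul_re]; ring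

/-- `(Im z)⁴ ≤ |z²|²`. [folklore] -/
theorem im_pow_four_le (z : ℂ) : z.im ^ 4 ≤ ‖z ^ 2‖ ^ 2 := by
  have h1 : z.im ^ 2 ≤ ‖z‖ ^ 2 := by
    rw [Complex.sq_norm, Complex.normSq_apply]; nlinarith [sq_nonneg z.re]
  calc z.im ^ 4 = (z.im ^ 2) ^ 2 := by ring
    _ ≤ (‖z‖ ^ 2) ^ 2 := pow_le_pow_left₀ (sq_nonneg _) h1 2
    _ = ‖z ^ 2‖ ^ 2 := by rw [norm_pow]

/-- **The first absolute moment of a trigonometric polynomial over primes.** Let `S` be a finite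
set of primes `≤ N`, `a : ℕ → ℂ`, `V = Σ_{p∈S} |a_p|²`, and `T ≥ 0` with `928 N² ≤ T` and
`1856 Σ_{p∈S} p|a_p|² + 4 (Σ_{p∈S} |a_p|)² ≤ T V/2`. Then
`∫_T^{2T} |Im Σ_{p∈S} a_p p^{it}| dt ≥ T √V / 20`.
Indeed `∫ F² = ½(∫|Z|² − Re ∫Z²) ≥ ½(TV − 1856 Σ p|a_p|² − 4(Σ|a_p|)²) ≥ TV/4`
(`integral_norm_sq_window`, `norm_integral_primePoly_sq_le`),
`∫ F⁴ ≤ ∫_0^{2T} |Z²|² ≤ (2T + 928 N²)·2V² ≤ 6TV²` (`primePoly_sq_eq`,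
`sum_norm_sq_sqCoeff_le`, Ivić Thm. 5.2), and `(∫F²)³ ≤ (∫|F|)² ∫F⁴`
(`pow_three_integral_sq_le`): `(∫|F|)² ≥ (TV/4)³/(6TV²) = T²V/384 ≥ (T√V/20)²`.
[cite: Titchmarsh1986, §9.26] [cite: Ivic1985, Theorem 5.2] -/
theorem first_moment_ge (hP : ∀ p ∈ S, p.Prime) (hS : S ⊆ Finset.Icc 1 N) {T : ℝ} (hT : 0 ≤ T)
    (hN : 928 * (N : ℝ) ^ 2 ≤ T)
    (hsmall : 1856 * (∑ p ∈ S, (p : ℝ) * ‖a p‖ ^ 2) + 4 * (∑ p ∈ S, ‖a p‖) ^ 2 ≤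
      T * (∑ p ∈ S, ‖a p‖ ^ 2) / 2) :
    T * Real.sqrt (∑ p ∈ S, ‖a p‖ ^ 2) / 20 ≤
      ∫ t in T..2 * T, |(∑ p ∈ S, a p * (p : ℂ) ^ ((t : ℂ) * I)).im| := by
  set V := ∑ p ∈ S, ‖a p‖ ^ 2 with hV
  have hV0 : 0 ≤ V := Finset.sum_nonneg fun p _ ↦ sq_nonneg _
  have h2S : ∀ p ∈ S, 2 ≤ p := fun p hp ↦ (hP p hp).two_le
  have hcont : Continuous fun t : ℝ ↦ ∑ p ∈ S, a p * (p : ℂ) ^ ((t : ℂ) * I) := continuous_primePoly hS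
  have hT2 : T ≤ 2 * T := by linarith
  set F : ℝ → ℝ := fun t ↦ ((∑ p ∈ S, a p * (p : ℂ) ^ ((t : ℂ) * I))).im with hFdef
  have hFc : Continuous F := Complex.continuous_im.comp hcont
  -- second moment from below
  have hI2 : T * V / 4 ≤ ∫ t in T..2 * T, F t ^ 2 := by
    have hw := integral_norm_sq_window N (fun n : ℕ ↦ if n ∈ S then a n else (0 : ℂ)) T
    rw [sum_norm_sq_restrictCoeff hS, sum_mul_norm_sq_restrictCoeff hS] at hw
    have hdir : ∀ t : ℝ, ‖∑ n ∈ Finset.Icc 1 N, (if n ∈ S then a n else (0 : ℂ)) * (n : ℂ) ^ ((t : ℂ) * I)‖ ^ 2 =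
        ‖(∑ p ∈ S, a p * (p : ℂ) ^ ((t : ℂ) * I))‖ ^ 2 := fun t ↦ by
      rw [primePoly_eq_dirPoly hS]
    simp_rw [hdir] at hw
    rw [← hV] at hw
    have hZ2 := norm_integral_primePoly_sq_le (a := a) h2S T (2 * T)
    have hi1 : IntervalIntegrable (fun t ↦ ‖(∑ p ∈ S, a p * (p : ℂ) ^ ((t : ℂ) * I))‖ ^ 2) volume T (2 * T) :=
      (hcont.norm.pow 2).intervalIntegrable _ _
    have hi2 : IntervalIntegrable (fun t ↦ ((∑ p ∈ S, a p * (p : ℂ) ^ ((t : ℂ) * I)) ^ 2).re) volume T (2 * T) :=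
      (Complex.continuous_re.comp (hcont.pow 2)).intervalIntegrable _ _
    have hre := intervalIntegral_re (μ := volume) (f := fun t : ℝ ↦ (∑ p ∈ S, a p * (p : ℂ) ^ ((t : ℂ) * I)) ^ 2)
      ((hcont.pow 2).intervalIntegrable T (2 * T))
    simp only [RCLike.re_to_complex] at hre
    have e : ∫ t in T..2 * T, F t ^ 2 =
        ∫ t in T..2 * T, (‖(∑ p ∈ S, a p * (p : ℂ) ^ ((t : ℂ) * I))‖ ^ 2 - ((∑ p ∈ S, a p * (p : ℂ) ^ ((t : ℂ) * I)) ^ 2).re) / 2 :=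
      intervalIntegral.integral_congr fun t _ ↦ im_sq_eq _
    rw [e, intervalIntegral.integral_div, intervalIntegral.integral_sub hi1 hi2, hre]
    have hre_le : (∫ t in T..2 * T, (∑ p ∈ S, a p * (p : ℂ) ^ ((t : ℂ) * I)) ^ 2).re ≤ 4 * (∑ p ∈ S, ‖a p‖) ^ 2 :=
      (Complex.re_le_norm _).trans hZ2
    have hw' := (abs_le.1 hw).1
    linarith
  -- fourth moment from above
  have hI4 : ∫ t in T..2 * T, F t ^ 4 ≤ 6 * T * V ^ 2 := by
    have hmono : ∫ t in T..2 * T, F t ^ 4 ≤ ∫ t in T..2 * T, ‖(∑ p ∈ S, a p * (p : ℂ) ^ ((t : ℂ) * I)) ^ 2‖ ^ 2 :=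
      intervalIntegral.integral_mono_on hT2 ((hFc.pow 4).intervalIntegrable _ _)
        ((((hcont.pow 2).norm).pow 2).intervalIntegrable _ _) fun t _ ↦ im_pow_four_le _
    have hext : ∫ t in T..2 * T, ‖(∑ p ∈ S, a p * (p : ℂ) ^ ((t : ℂ) * I)) ^ 2‖ ^ 2 ≤
        ∫ t in (0 : ℝ)..2 * T, ‖(∑ p ∈ S, a p * (p : ℂ) ^ ((t : ℂ) * I)) ^ 2‖ ^ 2 :=
      intervalIntegral.integral_mono_interval hT hT2 le_rfl
        (Eventually.of_forall fun t ↦ by positivity)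
        ((((hcont.pow 2).norm).pow 2).intervalIntegrable _ _)
    have h52 := integral_norm_sq_dirichletPoly_sub_le (N * N) (fun k : ℕ ↦ ∑ x ∈ (S ×ˢ S).filter (fun x ↦ x.1 * x.2 = k), a x.1 * a x.2) (2 * T)
    have hdir : ∀ t : ℝ, ‖(∑ k ∈ Finset.Icc 1 (N * N), (∑ x ∈ (S ×ˢ S).filter (fun x ↦ x.1 * x.2 = k), a x.1 * a x.2) * (k : ℂ) ^ ((t : ℂ) * I))‖ ^ 2 = ‖(∑ p ∈ S, a p * (p : ℂ) ^ ((t : ℂ) * I)) ^ 2‖ ^ 2 :=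
      fun t ↦ by rw [primePoly_sq_eq hS]
    simp_rw [hdir] at h52
    have hc1 := sum_norm_sq_sqCoeff_le (a := a) hP hS
    have hc2 := sum_mul_norm_sq_sqCoeff_le (a := a) hP hS
    rw [← hV] at hc1 hc2
    have h52' := (abs_le.1 h52).2
    have p1 := mul_le_mul_of_nonneg_left hc1 (by linarith : (0 : ℝ) ≤ 2 * T)
    have p2 : 928 * ∑ k ∈ Finset.Icc 1 (N * N), (k : ℝ) * ‖(∑ x ∈ (S ×ˢ S).filter (fun x ↦ x.1 * x.2 = k), a x.1 * a x.2)‖ ^ 2 ≤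
        928 * (2 * (N : ℝ) ^ 2 * V ^ 2) := by linarith
    have p3 := mul_le_mul_of_nonneg_right hN (by positivity : (0 : ℝ) ≤ 2 * V ^ 2)
    linarith
  -- Hölder and the arithmetic
  have hH := pow_three_integral_sq_le hFc hT2
  have hA0 : 0 ≤ ∫ t in T..2 * T, |F t| := intervalIntegral.integral_nonneg hT2 fun t _ ↦ abs_nonneg _
  rcases hV0.eq_or_lt with hV00 | hVpos
  · rw [← hV00, Real.sqrt_zero, mul_zero, zero_div]; exact hA0
  rcases hT.eq_or_lt with hT0 | hTpos
  · rw [← hT0]; simp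
  have hTV : 0 < T * V / 4 := by positivity
  -- `(TV/4)³ ≤ (∫F²)³ ≤ (∫|F|)² ∫F⁴ ≤ (∫|F|)² · 6TV²`
  have h1 : (T * V / 4) ^ 3 ≤ (∫ t in T..2 * T, |F t|) ^ 2 * (6 * T * V ^ 2) :=
    calc (T * V / 4) ^ 3 ≤ (∫ t in T..2 * T, F t ^ 2) ^ 3 := pow_le_pow_left₀ hTV.le hI2 3
      _ ≤ (∫ t in T..2 * T, |F t|) ^ 2 * ∫ t in T..2 * T, F t ^ 4 := hH
      _ ≤ (∫ t in T..2 * T, |F t|) ^ 2 * (6 * T * V ^ 2) :=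
          mul_le_mul_of_nonneg_left hI4 (sq_nonneg _)
  -- hence `T² V/384 ≤ (∫|F|)²`
  have h2 : (T * Real.sqrt V / 20) ^ 2 ≤ (∫ t in T..2 * T, |F t|) ^ 2 := by
    have hsq : (T * Real.sqrt V / 20) ^ 2 = T ^ 2 * V / 400 := by
      rw [div_pow, mul_pow, Real.sq_sqrt hV0]; norm_num
    rw [hsq]
    have h3 : T ^ 2 * V / 384 * (6 * T * V ^ 2) = (T * V / 4) ^ 3 := by ring
    have h4 : T ^ 2 * V / 384 ≤ (∫ t in T..2 * T, |F t|) ^ 2 :=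
      le_of_mul_le_mul_right (h3 ▸ h1) (by positivity)
    nlinarith
  exact (pow_le_pow_iff_left₀ (by positivity) hA0 two_ne_zero).1 h2

end PrimeTrigPoly

end Literature.NumberTheory.LFunctions

end
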